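import Literature.Analysis.ODE.LinearComparison
import Mathlib.Analysis.SpecialFunctions.Sqrt
import Mathlib.Analysis.SpecialFunctions.Pow.Deriv
import HarnessLib

/-!
# A linear comparison (Grönwall) lemma for the Euclidean norm of a vector of functions

E. Hairer, S. P. Nørsett, G. Wanner, *Solving Ordinary Differential Equations I*, §I.10
(Grönwall-type differential inequalities) [`HairerNorsettWanner1993`]; folklore.

For finitely many real functions `w i` on `[a, b]` with right derivatives `w' i` on `[a, b)` and the
"energy" inequality `∑ i, w i · w' i ≤ β · ∑ i, (w i)² + R · √(∑ i, (w i)²)` with continuous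
`β, R ≥ 0` — which is what one gets from a linear system `w' = M(t) w + r(t)` with operator bound
`‖M(t)‖ ≤ β(t)` and `‖r(t)‖ ≤ R(t)` — the Euclidean norm obeys the scalar linear comparison bound
`√(∑ (w i t)²) ≤ exp(∫ₐᵗ β) (√(∑ (w i a)²) + ∫ₐᵗ R)`.
(Proof: apply the scalar lemma `le_linearComparison` to `g_θ = √(θ² + ∑ (w i)²)`, `θ > 0`, which is
differentiable with `g_θ' = (∑ w i w' i)/g_θ ≤ β g_θ + R`, and let `θ → 0`.)
Used for the asymmetry rows of the split cascade over windows with time-dependent rates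
(cell harvest/h2-tao-ladder).

## References

* E. Hairer, S. P. Nørsett, G. Wanner, *Solving Ordinary Differential Equations I*, 2nd ed.,
  Springer 1993, §I.10. [`HairerNorsettWanner1993`]
-/

noncomputable section

open Set MeasureTheory intervalIntegral Filter Topology

namespace Literature.Analysis.ODE

/-- **Linear comparison for the Euclidean norm.** If `∑ i, w i · w' i ≤ β ∑ i (w i)² + R √(∑ i (w i)²)`
on `[a, b)` with `β, R ≥ 0` continuous on `[a, b]`, then for `t ∈ [a, b]`,
`√(∑ i (w i t)²) ≤ exp(∫ₐᵗ β) (√(∑ i (w i a)²) + ∫ₐᵗ R)`. [cite: HairerNorsettWanner1993, §I.10] -/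
theorem sqrt_sum_sq_le_linearComparison {ι : Type*} [Fintype ι] {a b : ℝ}
    {w w' : ι → ℝ → ℝ} {β R : ℝ → ℝ}
    (hw : ∀ i, ContinuousOn (w i) (Icc a b))
    (hw' : ∀ i, ∀ t ∈ Ico a b, HasDerivWithinAt (w i) (w' i t) (Ici t) t)
    (hβ : ContinuousOn β (Icc a b)) (hβ0 : ∀ t ∈ Icc a b, 0 ≤ β t)
    (hR : ContinuousOn R (Icc a b)) (hR0 : ∀ t ∈ Icc a b, 0 ≤ R t)
    (bound : ∀ t ∈ Ico a b,
      ∑ i, w i t * w' i t ≤ β t * ∑ i, w i t ^ 2 + R t * Real.sqrt (∑ i, w i t ^ 2))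
    {t : ℝ} (ht : t ∈ Icc a b) :
    Real.sqrt (∑ i, w i t ^ 2) ≤
      Real.exp (∫ s in a..t, β s) * (Real.sqrt (∑ i, w i a ^ 2) + ∫ s in a..t, R s) := by
  have hab : a ≤ t := ht.1
  set S : ℝ → ℝ := fun s => ∑ i, w i s ^ 2 with hS
  have hS0 : ∀ s, 0 ≤ S s := fun s => Finset.sum_nonneg fun i _ => sq_nonneg _
  have hSc : ContinuousOn S (Icc a b) := continuousOn_finsetSum _ fun i _ => (hw i).pow 2
  -- the integral `∫ₐᵗ β ≥ 0` and `∫ R e^{-B} ≤ ∫ R`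
  have hB0 : 0 ≤ ∫ s in a..t, β s :=
    intervalIntegral.integral_nonneg hab fun s hs => hβ0 s ⟨hs.1, hs.2.trans ht.2⟩
  have hE1 : 1 ≤ Real.exp (∫ s in a..t, β s) := Real.one_le_exp hB0
  have hRi : IntervalIntegrable R volume a t :=
    (hR.mono (Icc_subset_Icc le_rfl ht.2)).intervalIntegrable_of_Icc hab
  have hint_le : ∫ s in a..t, R s * Real.exp (-(∫ u in a..s, β u)) ≤ ∫ s in a..t, R s := by
    have hab' : a ≤ b := ht.1.trans ht.2
    set B : ℝ → ℝ := fun s => ∫ u in a..s, β u with hB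
    have hBc : ContinuousOn B (Icc a b) := by
      have : ∀ s ∈ Icc a b, B s = ∫ u in a..s, IccExtend hab' ((Icc a b).restrict β) u :=
        fun s hs => (primitive_IccExtend_eq hab' hs).symm
      refine ContinuousOn.congr ?_ this
      exact (continuous_primitive
        ((continuous_IccExtend_restrict hab' hβ).intervalIntegrable) a).continuousOn
    have hcont : ContinuousOn (fun s => R s * Real.exp (-B s)) (Icc a t) :=
      (hR.mono (Icc_subset_Icc le_rfl ht.2)).mul ((hBc.mono (Icc_subset_Icc le_rfl ht.2)).neg.rexp)
    show ∫ s in a..t, R s * Real.exp (-B s) ≤ ∫ s in a..t, R s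
    apply intervalIntegral.integral_mono_on hab (hcont.intervalIntegrable_of_Icc hab) hRi
    intro s hs
    have hBs : 0 ≤ B s :=
      intervalIntegral.integral_nonneg hs.1 fun u hu => hβ0 u ⟨hu.1, hu.2.trans (hs.2.trans ht.2)⟩
    have hexp : Real.exp (-B s) ≤ 1 := Real.exp_le_one_iff.mpr (by linarith)
    have hRs := hR0 s ⟨hs.1, hs.2.trans ht.2⟩
    calc R s * Real.exp (-B s) ≤ R s * 1 := mul_le_mul_of_nonneg_left hexp hRs
      _ = R s := mul_one _
  have hRint0 : 0 ≤ ∫ s in a..t, R s :=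
    intervalIntegral.integral_nonneg hab fun s hs => hR0 s ⟨hs.1, hs.2.trans ht.2⟩
  -- the regularised norm `g_θ = √(θ² + S)`
  refine le_of_forall_pos_le_add fun θ' hθ' => ?_
  -- choose `θ` with `exp(∫β) θ ≤ θ'`
  obtain ⟨θ, hθ, hθE⟩ : ∃ θ : ℝ, 0 < θ ∧ Real.exp (∫ s in a..t, β s) * θ ≤ θ' :=
    ⟨θ' / Real.exp (∫ s in a..t, β s), div_pos hθ' (Real.exp_pos _),
      by rw [mul_div_cancel₀ _ (Real.exp_pos _).ne']⟩
  set g : ℝ → ℝ := fun s => Real.sqrt (θ ^ 2 + S s) with hg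
  have hpos : ∀ s, 0 < θ ^ 2 + S s := fun s => by have := hS0 s; positivity
  have hgpos : ∀ s, 0 < g s := fun s => Real.sqrt_pos.2 (hpos s)
  have hgc : ContinuousOn g (Icc a b) := (continuousOn_const.add hSc).sqrt
  -- derivative of `g`
  have hg' : ∀ s ∈ Ico a b, HasDerivWithinAt g ((∑ i, 2 * w i s * w' i s) / (2 * g s)) (Ici s) s := by
    intro s hs
    have hSd : HasDerivWithinAt S (∑ i, 2 * w i s * w' i s) (Ici s) s := by
      have h1 : HasDerivWithinAt (fun y => ∑ i ∈ Finset.univ, w i y ^ 2)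
          (∑ i ∈ Finset.univ, ((2 : ℕ) : ℝ) * w i s ^ (2 - 1) * w' i s) (Ici s) s :=
        HasDerivWithinAt.fun_sum fun i _ => (hw' i s hs).pow 2
      have e : ∑ i ∈ Finset.univ, ((2 : ℕ) : ℝ) * w i s ^ (2 - 1) * w' i s =
          ∑ i, 2 * w i s * w' i s := Finset.sum_congr rfl fun i _ => by norm_num
      rw [e] at h1
      exact h1
    have h1 : HasDerivWithinAt (fun y => θ ^ 2 + S y) (∑ i, 2 * w i s * w' i s) (Ici s) s := by
      simpa using hSd.const_add (θ ^ 2)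
    exact h1.sqrt (hpos s).ne'
  -- the differential inequality `g' ≤ R + β g`
  have hbound : ∀ s ∈ Ico a b, (∑ i, 2 * w i s * w' i s) / (2 * g s) ≤ R s + β s * g s := by
    intro s hs
    have hsI : s ∈ Icc a b := Ico_subset_Icc_self hs
    have hb := bound s hs
    have hgs := hgpos s
    have hsum : ∑ i, 2 * w i s * w' i s = 2 * ∑ i, w i s * w' i s := by
      rw [Finset.mul_sum]; congr 1; ext i; ring
    rw [hsum, div_le_iff₀ (by positivity)]
    -- `√S ≤ g` and `S ≤ g²`
    have hSg : Real.sqrt (S s) ≤ g s := Real.sqrt_le_sqrt (by linarith [sq_nonneg θ])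
    have hS2 : S s ≤ g s ^ 2 := by
      rw [hg, Real.sq_sqrt (hpos s).le]; linarith [sq_nonneg θ]
    have hβs := hβ0 s hsI
    have hRs := hR0 s hsI
    have e1 : β s * S s ≤ β s * g s ^ 2 := mul_le_mul_of_nonneg_left hS2 hβs
    have e2 : R s * Real.sqrt (S s) ≤ R s * g s := mul_le_mul_of_nonneg_left hSg hRs
    nlinarith [hb, e1, e2, hgs]
  have hmain := le_linearComparison hgc hg' hR hβ hbound ht
  -- unwind
  have hga : g a ≤ θ + Real.sqrt (S a) := by
    have hSa := hS0 a
    have h2 : θ ^ 2 + S a ≤ (θ + Real.sqrt (S a)) ^ 2 := by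
      have e : (θ + Real.sqrt (S a)) ^ 2 = θ ^ 2 + 2 * θ * Real.sqrt (S a) + Real.sqrt (S a) ^ 2 := by
        ring
      rw [e, Real.sq_sqrt hSa]
      have : 0 ≤ 2 * θ * Real.sqrt (S a) := by positivity
      linarith
    calc g a = Real.sqrt (θ ^ 2 + S a) := rfl
      _ ≤ Real.sqrt ((θ + Real.sqrt (S a)) ^ 2) := Real.sqrt_le_sqrt h2
      _ = θ + Real.sqrt (S a) := Real.sqrt_sq (by positivity)
  have hgt : Real.sqrt (S t) ≤ g t := Real.sqrt_le_sqrt (by linarith [sq_nonneg θ])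
  have hE0 : 0 ≤ Real.exp (∫ s in a..t, β s) := (Real.exp_pos _).le
  calc Real.sqrt (S t) ≤ g t := hgt
    _ ≤ Real.exp (∫ s in a..t, β s) * (g a + ∫ s in a..t, R s * Real.exp (-(∫ u in a..s, β u))) :=
        hmain
    _ ≤ Real.exp (∫ s in a..t, β s) * (θ + Real.sqrt (S a) + ∫ s in a..t, R s) := by
        apply mul_le_mul_of_nonneg_left _ hE0
        linarith [hga, hint_le]
    _ = Real.exp (∫ s in a..t, β s) * (Real.sqrt (S a) + ∫ s in a..t, R s) +
          Real.exp (∫ s in a..t, β s) * θ := by ring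
    _ ≤ _ := by linarith [hθE]

end Literature.Analysis.ODE
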